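import Summits.BirchSwinnertonDyer.Rank1Residual.Additive.IntModelConductorCertificate
import HarnessLib

/-!
# The conductor of the level-`27` curves `27a1 = X₀(27)` and `27a3` is `27`, as a KERNEL NUMERAL — Tate certificates at `3`
(route `ManinLocalTwoThree`, crux C3 `ManinPrimeToThreeAtNine` stmt-BirchSwinnertonDyer-22968; cell bsd-f2-manin, prover seat p3 gen 22;
`--supports stmt-BirchSwinnertonDyer-22968`)

C3 (`9 ∣ N ⟹ 3 ∤ c₀`) quantifies over lattice-optimal `X₀(N)`-data of globally minimal curves at levels divisible by `9`; the cell's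
conditional closer `CDivisionInt.maninPrimeToThreeAtNine_of_CDTInt` (C3 ⟸ CDT) is a `∀` over that domain.  The first additive level with
`9 ∣ N` carrying an elliptic curve is `N = 27 = 3³` (isogeny class `27a`, the curve `X₀(27)` itself).  This file supplies the ARITHMETIC half of
the `N = 27` witness — the conductor — with NO named fact, by the rank-2 observatory's kernel Tate certificates
(`IntModelCond.conductorNorm_mk_eq_of_certs_of_eq`: a minimality certificate, the `2`- and `3`-adic valuation certificate, a local certificate at `2`
and a Tate certificate at `3`, each re-verified by `decide +kernel`):

* `conductorNorm_twentySevenA3` — **`N(27a3) = 27`** for `y² + y = x³` (`[0, 0, 1, 0, 0]`, `Δ = −27`): Tate's algorithm at `3` exits at Step 3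
  (Kodaira type `II`, `v₃(Δ) = 3`, one component, `f₃ = 3 + 1 − 1 = 3`, WILD), good at `2`;
* `conductorNorm_twentySevenA1` — **`N(27a1) = 27`** for `y² + y = x³ − 7` (`[0, 0, 1, 0, −7]` = `X₀(27)`, `Δ = −3⁹`): Step 8 (type `IV*`,
  `v₃(Δ) = 9`, seven components, `f₃ = 9 + 1 − 7 = 3`), good at `2`;
* the same two numerals for the `ℤ`-models base-changed to `ℚ` (`conductorNorm_baseChange_twentySevenA1/A3`) — the literal shape of the
  hypothesis `hNA : ((⟨0, 0, 1, 0, -7⟩ : WeierstrassCurve ℤ).baseChange ℚ).conductorNorm ℤ = 27` carried by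
  `Theorems/ResidualThetaTransportAtTwoSignedMuVanishingAtTwoPlusMultOneClass157113h.lean` and `…CuspSpanAnchorClasses.lean`, now ONE `exact` away;
* global minimality and ellipticity of the literal model of `27a1` (`isGloballyMinimal_twentySevenA1`, `isElliptic_twentySevenA1`; theorems, use `haveI`;
  for `27a3` they are the tree's `EtaBDMTVPrimes.isElliptic_A3z` / `isGloballyMinimal_A3z`),
  and `27 ≠ 0`, `3² ∣ 27` for the C3 binder block.

HONEST FRAMING: pure certificate arithmetic (Tate's algorithm + Ogg's formula in the tree's own conductor currency `WeierstrassCurve.conductorNorm`);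
nothing here touches the Manin constant; C3, Manin's conjecture and BSD are NOT proved by this file.  No definition, no named fact, no sorry.
[cite: Silverman1994, IV.9.4 (Tate's algorithm, Steps 3 and 8) and IV.11.1 (Ogg's formula)] [cite: CremonaAlgorithms1997, Table 1 (labels 27a1, 27a3)]
-/

set_option autoImplicit false
-- lint-debt: the directory name repeats the summit name (sibling precedent `ManinLocalTwoThreeManinOddAtFourInhabited.lean`)
set_option linter.dupNamespace false

open WeierstrassCurve
open Summit.BirchSwinnertonDyer.BirchSwinnertonDyer.Rank2Observatory
open Summit.BirchSwinnertonDyer.BirchSwinnertonDyer.Rank2Observatory.RootNumber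
open Summit.BirchSwinnertonDyer.BirchSwinnertonDyer.Rank2Observatory.Tate
open Summit.BirchSwinnertonDyer.Rank1Residual.Additive

namespace Summit.BirchSwinnertonDyer.BirchSwinnertonDyer.Theorems.ManinLocalTwoThree.LevelTwentySeven

/-! ## §1 `27a3 : y² + y = x³` -/

/-- The literal `ℚ`-model `[0, 0, 1, 0, 0]` read through integer casts (the currency of the certificate lemma). [folklore] -/
theorem mk_twentySevenA3_eq_cast :
    (⟨0, 0, 1, 0, 0⟩ : WeierstrassCurve ℚ) = ⟨((0 : ℤ) : ℚ), ((0 : ℤ) : ℚ), ((1 : ℤ) : ℚ), ((0 : ℤ) : ℚ), ((0 : ℤ) : ℚ)⟩ := by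
  ext <;> norm_num

/-- **`N(27a3) = 27 = 3³`** (`y² + y = x³`, `Δ = −27`): Tate certificate at `3` = translation `(r, s, t) = (−1, 0, 1)` to
`y² + 3y = x³ − 3x² + 3x − 3`, Step-3 exit (`3 ∥ a₆`): Kodaira type `II`, `f₃ = v₃(Δ) = 3`; good reduction at `2`.  NO named fact.
[cite: Silverman1994, IV.9.4 Step 3 and IV.11.1] [cite: CremonaAlgorithms1997, Table 1 (27a3)] -/
theorem conductorNorm_twentySevenA3 : (⟨0, 0, 1, 0, 0⟩ : WeierstrassCurve ℚ).conductorNorm ℤ = 27 := by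
  rw [mk_twentySevenA3_eq_cast]
  exact IntModelCond.conductorNorm_mk_eq_of_certs_of_eq 0 0 1 0 0
    (cm := ⟨0, 0, 3, [⟨3, 1, 3, 2, 0⟩]⟩) (c := ⟨0, 0, 3, 3, 0, 3, []⟩)
    (l₂ := ⟨0, 0, 0, 0, 0, 0, 0⟩) (l₃ := ⟨2, -1, 0, 1, 3, 2, 0⟩)
    (by decide +kernel) (by decide +kernel) (by decide +kernel) (by decide +kernel) (by decide +kernel)

-- `IsElliptic` / `IsGloballyMinimal` of the literal `[0, 0, 1, 0, 0]` are ALREADY in the tree (`EtaBDMTVPrimes.isElliptic_A3z`,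
-- `EtaBDMTVPrimes.isGloballyMinimal_A3z`, `Theorems/QuadraticBranchSignedControlPlusEtaNonsurjBDMTVPrimesRows.lean`) — not restated here.

/-- The `ℤ`-model `[0, 0, 1, 0, 0]` base-changed to `ℚ` has conductor `27`. [cite: CremonaAlgorithms1997, Table 1 (27a3)] -/
theorem conductorNorm_baseChange_twentySevenA3 :
    ((⟨0, 0, 1, 0, 0⟩ : WeierstrassCurve ℤ).baseChange ℚ).conductorNorm ℤ = 27 := by
  rw [IntModelTam.baseChange_rat_mk_int, ← mk_twentySevenA3_eq_cast]
  exact conductorNorm_twentySevenA3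

/-! ## §2 `27a1 = X₀(27) : y² + y = x³ − 7` -/

/-- The literal `ℚ`-model `[0, 0, 1, 0, −7]` read through integer casts. [folklore] -/
theorem mk_twentySevenA1_eq_cast :
    (⟨0, 0, 1, 0, -7⟩ : WeierstrassCurve ℚ) = ⟨((0 : ℤ) : ℚ), ((0 : ℤ) : ℚ), ((1 : ℤ) : ℚ), ((0 : ℤ) : ℚ), ((-7 : ℤ) : ℚ)⟩ := by
  ext <;> norm_num

/-- **`N(27a1) = 27 = 3³`** (`y² + y = x³ − 7`, the curve `X₀(27)`, `Δ = −3⁹`): deep Tate certificate at `3` = translation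
`(r, s, t) = (3, 0, 4)` to `y² + 9y = x³ + 9x² + 27x`, Step-8 exit (`(a₃/9)² + 4a₆/81 = 1 ≢ 0`): Kodaira type `IV*` (seven components),
`f₃ = 9 + 1 − 7 = 3`; good reduction at `2`.  NO named fact. [cite: Silverman1994, IV.9.4 Step 8 and IV.11.1] [cite: CremonaAlgorithms1997, Table 1 (27a1)] -/
theorem conductorNorm_twentySevenA1 : (⟨0, 0, 1, 0, -7⟩ : WeierstrassCurve ℚ).conductorNorm ℤ = 27 := by
  rw [mk_twentySevenA1_eq_cast]
  exact IntModelCond.conductorNorm_mk_eq_of_certs_of_eq 0 0 1 0 (-7)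
    (cm := ⟨0, 0, 3, [⟨3, 1, 9, 2, 0⟩]⟩) (c := ⟨0, 0, 3, 9, 0, 6, []⟩)
    (l₂ := ⟨0, 0, 0, 0, 0, 0, 0⟩) (l₃ := ⟨3, 3, 0, 4, 9, 8, 0⟩)
    (by decide +kernel) (by decide +kernel) (by decide +kernel) (by decide +kernel) (by decide +kernel)

/-- `[0, 0, 1, 0, −7]` is a globally minimal model (`v₃(Δ) = 9 < 12`, no other bad prime). [cite: SilvermanAEC2009, VII.1 Remark 1.1] -/
theorem isGloballyMinimal_twentySevenA1 : (⟨0, 0, 1, 0, -7⟩ : WeierstrassCurve ℚ).IsGloballyMinimal := by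
  rw [mk_twentySevenA1_eq_cast]
  exact IntModelCond.isGloballyMinimal_mk_of_minCheck 0 0 1 0 (-7) (cm := ⟨0, 0, 3, [⟨3, 1, 9, 2, 0⟩]⟩) (by decide +kernel)

/-- `[0, 0, 1, 0, −7]` is an elliptic curve (`Δ = −3⁹ ≠ 0`); a theorem, not a global instance (use `haveI`). [folklore] -/
theorem isElliptic_twentySevenA1 : (⟨0, 0, 1, 0, -7⟩ : WeierstrassCurve ℚ).IsElliptic :=
  ⟨by norm_num [WeierstrassCurve.Δ, WeierstrassCurve.b₂, WeierstrassCurve.b₄, WeierstrassCurve.b₆, WeierstrassCurve.b₈]⟩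

/-- **The `hNA` binder of the `ResidualThetaTransportAtTwo…` records, discharged**: the `ℤ`-model `[0, 0, 1, 0, −7]` base-changed to `ℚ` has
conductor `27`. [cite: CremonaAlgorithms1997, Table 1 (27a1)] -/
theorem conductorNorm_baseChange_twentySevenA1 :
    ((⟨0, 0, 1, 0, -7⟩ : WeierstrassCurve ℤ).baseChange ℚ).conductorNorm ℤ = 27 := by
  rw [IntModelTam.baseChange_rat_mk_int, ← mk_twentySevenA1_eq_cast]
  exact conductorNorm_twentySevenA1

/-! ## §3 The C3 binder block at `N = 27` -/

/-- `27 ≠ 0` as a `NeZero` fact (the level instance of the C3 domain at `27`; a theorem, use `haveI`). [folklore] -/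
theorem neZero_twentySeven : NeZero (27 : ℕ) := ⟨by decide⟩

/-- `3² ∣ 27`: the level `27` lies in C3's `9 ∣ N` world. [folklore] -/
theorem three_sq_dvd_twentySeven : 3 ^ 2 ∣ 27 := ⟨3, by norm_num⟩

/-- `3² ∣ N(27a3)`: the curve `y² + y = x³` is additive at `3` with `9` dividing its conductor. [cite: CremonaAlgorithms1997, Table 1 (27a3)] -/
theorem three_sq_dvd_conductorNorm_twentySevenA3 : (3 : ℕ) ^ 2 ∣ (⟨0, 0, 1, 0, 0⟩ : WeierstrassCurve ℚ).conductorNorm ℤ := by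
  rw [conductorNorm_twentySevenA3]; exact three_sq_dvd_twentySeven

/-- `3² ∣ N(27a1)`. [cite: CremonaAlgorithms1997, Table 1 (27a1)] -/
theorem three_sq_dvd_conductorNorm_twentySevenA1 : (3 : ℕ) ^ 2 ∣ (⟨0, 0, 1, 0, -7⟩ : WeierstrassCurve ℚ).conductorNorm ℤ := by
  rw [conductorNorm_twentySevenA1]; exact three_sq_dvd_twentySeven

end Summit.BirchSwinnertonDyer.BirchSwinnertonDyer.Theorems.ManinLocalTwoThree.LevelTwentySeven
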